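import Summits.BirchSwinnertonDyer.BirchSwinnertonDyer.Theorems.UniversalToricDescentThinCombDefs
import Summits.BirchSwinnertonDyer.BirchSwinnertonDyer.Theorems.UniversalToricDescentThinCombDescentShear
import Summits.BirchSwinnertonDyer.BirchSwinnertonDyer.Theorems.PrintCf2RubinValueTwoValueRigidityOfCharIdeal
import Literature.NumberTheory.EllipticCurves.ToricTwoVariablePAdicLFunction
import Literature.NumberTheory.EllipticCurves.BDPAnticyclotomicPAdicLFunction
import Summits.BirchSwinnertonDyer.Rank1Residual.X11b.IntSeriesComposition
import Summits.BirchSwinnertonDyer.BirchSwinnertonDyer.Theorems.RamifiedSevenEllipticUnitsLemmaXiAvatarNorm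
import HarnessLib

/-!
# Line `thin_comb` on the WALL `AdditiveSplitIMCInclusionAtThree` (stmt-BirchSwinnertonDyer-20395) — TWO-VARIABLE VALUE
# COMPATIBILITY ALONG THE ANTICYCLOTOMIC LINE and the LINE GEOMETRY of a v2 frame (inputs (ii), (iii) of K3b
# `stub_lineRestrictionIsBDP`; any prime) — helper, `--supports stmt-BirchSwinnertonDyer-20395`; AUTHORED by the ideation
# planner `bsd-wall-utd-idea` g46 (S-g46-3 `LineValue-utd-idea-g46.lean` c870839ec7e2c5c2, evidence #48; `LineGeometry-utd-idea-g46.lean`,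
# evidence #45; §A of `K3Split-utd-idea-g46.lean`, evidence #47), LANDED verbatim (namespaces moved under `Theorems`) by the lead
# `cruxlead-20395` g3 (cell `pub/bsd-wall`).

* §A (any commutative ring): `F − (φ_e F)(T₁) ∈ (T₂ − ((1+T₁)^e − 1))` — every two-variable series is congruent, modulo the
  line ideal, to its specialisation `φ_e = TwoVarSubst.spec e` (`T₁ ↦ T`, `1 + T₂ ↦ (1+T)^e`) read in the outer variable
  (`sub_toOuter_spec_mem_span`, from the tree's shear `α_e`, `β_e = α_e⁻¹`, `spec_e ∘ α_e = constantCoeff`); with the unit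
  `u = 1` in the `…ThinCombDefs` coordinates (`sub_one_mul_map_spec_mem_lineIdeal`).
* §B–§C (`R₀ = unrIntegers p`, `‖x‖ < 1`): values on the open bidisc (`1`, `T₁`, `T₂`, sums, products, powers, `L(T₁)`), the
  line generator vanishes on the line, and **`UnrSeries.HasValueAt₂ F x ((1+x)^e − 1) v ↔ UnrSeries.HasValueAt (spec e F) x v`**
  (`hasValueAt₂_line_iff_hasValueAt_spec`).
* §D (any `p`, any `K`): for a rank-one avatar `r` through `κ` and frame relations `γ₁γ⁻¹ ∈ ker κ`, `γ₂(γ^{p^k})⁻¹ ∈ ker κ`: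
  `avatarValueAt r γ₁ = avatarValueAt r γ`, `avatarValueAt r γ₂ = (avatarValueAt r γ)^{p^k}` — the interpolation point of a
  `κ`-character lies on the line `T₂ = (1+T₁)^{p^k} − 1`.

Theorems only; no definition, no named fact, no `sorry`. Nothing about BSD is proved here.
-/

set_option linter.dupNamespace false
set_option autoImplicit false

noncomputable section

open Literature.NumberTheory.EllipticCurves
open Summit.BirchSwinnertonDyer.BirchSwinnertonDyer.Theorems.UniversalToricDescentThinComb
open Summit.BirchSwinnertonDyer.BirchSwinnertonDyer.Theorems.UniversalToricDescentThinComb.TwoVarSubst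

namespace Summit.BirchSwinnertonDyer.BirchSwinnertonDyer.Theorems.UniversalToricDescentThinComb.LineValue

/-! ## §A  Algebra: the kernel element of `φ_e` -/

section Algebra

variable {R : Type*} [CommRing R]

/-- `α_e (f(T₂)) = f(T₁)`. -/
theorem alpha_C (e : ℕ) (f : PowerSeries R) : alpha (R := R) e (PowerSeries.C f) = toOuter f := by
  unfold alpha
  exact substOuter_C _ _ f

/-- **`F − (φ_e F)(T₁) ∈ (T₂ − ((1+T₁)^e − 1))`.** [folklore; Bourbaki A IV §4 no. 3] -/
theorem sub_toOuter_spec_mem_span (e : ℕ) (F : PowerSeries (PowerSeries R)) :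
    F - toOuter (spec e F) ∈ Ideal.span {PowerSeries.C PowerSeries.X - uOuter (R := R) e} := by
  set H : PowerSeries (PowerSeries R) := beta e F with hH
  have hF : alpha e H = F := by
    have h := congrArg (fun φ : PowerSeries (PowerSeries R) →+* PowerSeries (PowerSeries R) => φ F)
      (alpha_comp_beta (R := R) e)
    simpa [hH] using h
  have hspec : spec e F = PowerSeries.constantCoeff H := by
    have h := congrArg (fun φ : PowerSeries (PowerSeries R) →+* PowerSeries R => φ F)
      (constantCoeff_comp_beta (R := R) e)
    simpa [hH] using h.symm
  rw [Ideal.mem_span_singleton]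
  refine ⟨alpha e (PowerSeries.mk fun n => PowerSeries.coeff (n + 1) H), ?_⟩
  calc F - toOuter (spec e F)
      = alpha e H - alpha e (PowerSeries.C (PowerSeries.constantCoeff H)) := by rw [hF, hspec, alpha_C]
    _ = alpha e (H - PowerSeries.C (PowerSeries.constantCoeff H)) := by rw [map_sub]
    _ = (PowerSeries.C PowerSeries.X - uOuter e) * alpha e (PowerSeries.mk fun n => PowerSeries.coeff (n + 1) H) := by
          rw [PowerSeries.sub_const_eq_X_mul_shift H, map_mul, alpha_X]

/-- The same congruence in the coordinates `T₁ = X`, `T₂ = C X` of `…ThinCombDefs` and with the unit `u = 1` (the exact shape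
consumed by `stub_descent` / produced by `stub_toricTwoVarL` of line `thin_comb`): `F − 1·(φ_e F)(T₁) ∈ (T₂ − ((1+T₁)^e − 1))`.
[folklore; Bourbaki A IV §4 no. 3] -/
theorem sub_one_mul_map_spec_mem_lineIdeal (e : ℕ) (F : PowerSeries (PowerSeries R)) :
    F - ((1 : (PowerSeries (PowerSeries R))ˣ) : PowerSeries (PowerSeries R)) *
        PowerSeries.map (PowerSeries.C (R := R)) (spec e F) ∈
      Ideal.span {T₂ R - ((1 + T₁ R) ^ e - 1)} := by
  rw [Units.val_one, one_mul]
  exact sub_toOuter_spec_mem_span e F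

end Algebra

/-! ## §B  Values on the open bidisc: `1`, `T₁`, `T₂`, sums, products, powers, `L(T₁)` -/

variable {p : ℕ} [Fact p.Prime]

/-- The value of a series supported at one index. -/
theorem hasValueAt₂_of_single (F : PowerSeries (UnrSeries p)) (x y : ℂ_[p]) (i₀ j₀ : ℕ)
    (h : ∀ k : ℕ × ℕ, k ≠ (i₀, j₀) → PowerSeries.coeff k.2 (PowerSeries.coeff k.1 F) = 0) :
    UnrSeries.HasValueAt₂ F x y
      (((PowerSeries.coeff j₀ (PowerSeries.coeff i₀ F) : unrIntegers p) : ℂ_[p]) * x ^ i₀ * y ^ j₀) := by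
  unfold UnrSeries.HasValueAt₂
  have := hasSum_single (f := fun k : ℕ × ℕ ↦
    ((PowerSeries.coeff k.2 (PowerSeries.coeff k.1 F) : unrIntegers p) : ℂ_[p]) * x ^ k.1 * y ^ k.2) (i₀, j₀)
    (fun k hk ↦ by rw [h k hk]; simp)
  simpa using this

/-- `1` has the value `1`. -/
theorem hasValueAt₂_one (x y : ℂ_[p]) : UnrSeries.HasValueAt₂ (1 : PowerSeries (UnrSeries p)) x y 1 := by
  have h := hasValueAt₂_of_single (1 : PowerSeries (UnrSeries p)) x y 0 0 (fun k hk ↦ by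
    rcases k with ⟨i, j⟩
    by_cases hi : i = 0
    · subst hi
      have hj : j ≠ 0 := fun hj ↦ hk (by rw [hj])
      simp [PowerSeries.coeff_one, hj]
    · simp [PowerSeries.coeff_one, hi])
  simpa [PowerSeries.coeff_one] using h

/-- `T₁ = X` has the value `x`. -/
theorem hasValueAt₂_X (x y : ℂ_[p]) : UnrSeries.HasValueAt₂ (PowerSeries.X : PowerSeries (UnrSeries p)) x y x := by
  have h := hasValueAt₂_of_single (PowerSeries.X : PowerSeries (UnrSeries p)) x y 1 0 (fun k hk ↦ by
    rcases k with ⟨i, j⟩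
    by_cases hi : i = 1
    · subst hi
      have hj : j ≠ 0 := fun hj ↦ hk (by rw [hj])
      simp [PowerSeries.coeff_X, PowerSeries.coeff_one, hj]
    · simp [PowerSeries.coeff_X, hi])
  simpa [PowerSeries.coeff_X, PowerSeries.coeff_one] using h

/-- `T₂ = C X` has the value `y`. -/
theorem hasValueAt₂_C_X (x y : ℂ_[p]) :
    UnrSeries.HasValueAt₂ (PowerSeries.C PowerSeries.X : PowerSeries (UnrSeries p)) x y y := by
  have h := hasValueAt₂_of_single (PowerSeries.C PowerSeries.X : PowerSeries (UnrSeries p)) x y 0 1 (fun k hk ↦ by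
    rcases k with ⟨i, j⟩
    by_cases hi : i = 0
    · subst hi
      have hj : j ≠ 1 := fun hj ↦ hk (by rw [hj])
      simp [PowerSeries.coeff_C, PowerSeries.coeff_X, hj]
    · simp [PowerSeries.coeff_C, hi])
  simpa [PowerSeries.coeff_C, PowerSeries.coeff_X] using h

/-- Values add. -/
theorem hasValueAt₂_add {F G : PowerSeries (UnrSeries p)} {x y v w : ℂ_[p]}
    (hF : UnrSeries.HasValueAt₂ F x y v) (hG : UnrSeries.HasValueAt₂ G x y w) :
    UnrSeries.HasValueAt₂ (F + G) x y (v + w) := by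
  unfold UnrSeries.HasValueAt₂ at *
  refine (hF.add hG).congr_fun fun k ↦ ?_
  rw [map_add, map_add]
  push_cast
  ring

/-- Values multiply (open bidisc). -/
theorem hasValueAt₂_mul {F G : PowerSeries (UnrSeries p)} {x y v w : ℂ_[p]} (hx : ‖x‖ < 1) (hy : ‖y‖ < 1)
    (hF : UnrSeries.HasValueAt₂ F x y v) (hG : UnrSeries.HasValueAt₂ G x y w) :
    UnrSeries.HasValueAt₂ (F * G) x y (v * w) := by
  rw [UnrSeries.hasValueAt₂_iff_toInt₂] at *
  rw [map_mul]
  exact Summit.BirchSwinnertonDyer.BirchSwinnertonDyer.Theorems.PrintCf2.RubinValueTwoReadout.hasValueAt₂_mul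
    hx hy hF hG

/-- Values of powers. -/
theorem hasValueAt₂_pow {F : PowerSeries (UnrSeries p)} {x y v : ℂ_[p]} (hx : ‖x‖ < 1) (hy : ‖y‖ < 1)
    (hF : UnrSeries.HasValueAt₂ F x y v) (n : ℕ) : UnrSeries.HasValueAt₂ (F ^ n) x y (v ^ n) := by
  induction n with
  | zero => simpa using hasValueAt₂_one x y
  | succ n ih => rw [pow_succ, pow_succ]; exact hasValueAt₂_mul hx hy ih hF

/-- A value exists at every point of the open bidisc. -/
theorem exists_hasValueAt₂ (F : PowerSeries (UnrSeries p)) {x y : ℂ_[p]} (hx : ‖x‖ < 1) (hy : ‖y‖ < 1) :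
    ∃ v : ℂ_[p], UnrSeries.HasValueAt₂ F x y v := by
  obtain ⟨v, hv⟩ :=
    Summit.BirchSwinnertonDyer.BirchSwinnertonDyer.Theorems.PrintCf2.KatzMeasureValue.exists_hasValueAt₂_of_norm_lt_one
      (UnrSeries.toInt₂ F) hx hy
  exact ⟨v, (UnrSeries.hasValueAt₂_iff_toInt₂ F x y v).mpr hv⟩

/-- **`u_e(T₁) = (1+T₁)^e − 1` has the value `(1+x)^e − 1`.** -/
theorem hasValueAt₂_uOuter (e : ℕ) {x y : ℂ_[p]} (hx : ‖x‖ < 1) (hy : ‖y‖ < 1) :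
    UnrSeries.HasValueAt₂ (uOuter (R := unrIntegers p) e) x y ((1 + x) ^ e - 1) := by
  rw [uOuter_def]
  exact (hasValueAt₂_pow hx hy (hasValueAt₂_add (hasValueAt₂_one x y) (hasValueAt₂_X x y)) e).sub
    (hasValueAt₂_one x y)

/-- **The line generator vanishes on the line**: `(T₂ − u_e(T₁))(x, (1+x)^e − 1) = 0`. -/
theorem hasValueAt₂_lineGen_zero (e : ℕ) {x : ℂ_[p]} (hx : ‖x‖ < 1) (hy : ‖(1 + x) ^ e - 1‖ < 1) :
    UnrSeries.HasValueAt₂ (PowerSeries.C PowerSeries.X - uOuter (R := unrIntegers p) e) x ((1 + x) ^ e - 1) 0 := by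
  have h := (hasValueAt₂_C_X x ((1 + x) ^ e - 1)).sub (hasValueAt₂_uOuter (p := p) e hx hy)
  rwa [sub_self] at h

/-- **`(L(T₁))(x, y) = L(x)`**: the outer reading `toOuter L = PowerSeries.map C L` has at `(x, y)` exactly the
values of `L` at `x`. -/
theorem hasValueAt₂_toOuter_iff (L : UnrSeries p) (x y v : ℂ_[p]) :
    UnrSeries.HasValueAt₂ (toOuter L) x y v ↔ UnrSeries.HasValueAt L x v := by
  unfold UnrSeries.HasValueAt₂ UnrSeries.HasValueAt
  set f : ℕ × ℕ → ℂ_[p] := fun k ↦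
    ((PowerSeries.coeff k.2 (PowerSeries.coeff k.1 (toOuter L)) : unrIntegers p) : ℂ_[p]) * x ^ k.1 * y ^ k.2 with hf
  set g : ℕ → ℕ × ℕ := fun i ↦ (i, 0) with hg
  have hinj : Function.Injective g := fun a b h ↦ (Prod.mk.inj h).1
  have hzero : ∀ k ∉ Set.range g, f k = 0 := by
    intro k hk
    have hk2 : k.2 ≠ 0 := by
      rintro h0
      exact hk ⟨k.1, Prod.ext rfl h0.symm⟩
    simp [hf, toOuter, PowerSeries.coeff_map, PowerSeries.coeff_C, hk2]
  have key : f ∘ g = fun i : ℕ ↦ ((PowerSeries.coeff i L : unrIntegers p) : ℂ_[p]) * x ^ i := by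
    funext i
    simp [hf, hg, Function.comp, toOuter, PowerSeries.coeff_map]
  constructor
  · intro h
    have h' := (hinj.hasSum_iff hzero).mpr h
    rwa [key] at h'
  · intro h
    rw [← key] at h
    exact (hinj.hasSum_iff hzero).mp h

/-! ## §C  The compatibility -/

/-- **Value compatibility along the line** (input (ii) of K3b): a value of `F` at `(x, (1+x)^e − 1)` is a value of
`φ_e F` at `x`. -/
theorem hasValueAt_spec_of_hasValueAt₂ (e : ℕ) {F : PowerSeries (UnrSeries p)} {x v : ℂ_[p]} (hx : ‖x‖ < 1)
    (hF : UnrSeries.HasValueAt₂ F x ((1 + x) ^ e - 1) v) : UnrSeries.HasValueAt (spec e F) x v := by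
  have hy := Summit.BirchSwinnertonDyer.Rank1Residual.X11b.norm_one_add_pow_sub_one_lt hx e
  obtain ⟨Q, hQ⟩ := Ideal.mem_span_singleton'.mp (sub_toOuter_spec_mem_span e F)
  -- `Q * g = F − toOuter (spec F)`
  obtain ⟨w, hw⟩ := exists_hasValueAt₂ Q hx hy
  have hg := hasValueAt₂_lineGen_zero (p := p) e hx hy
  have hprod : UnrSeries.HasValueAt₂ (F - toOuter (spec e F)) x ((1 + x) ^ e - 1) 0 := by
    have := hasValueAt₂_mul hx hy hw hg
    rwa [mul_zero, hQ] at this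
  have h := hF.sub hprod
  rw [sub_sub_cancel, sub_zero] at h
  exact (hasValueAt₂_toOuter_iff _ _ _ _).mp h

/-- Conversely, a value of `φ_e F` at `x` is a value of `F` at `(x, (1+x)^e − 1)`. -/
theorem hasValueAt₂_of_hasValueAt_spec (e : ℕ) {F : PowerSeries (UnrSeries p)} {x v : ℂ_[p]} (hx : ‖x‖ < 1)
    (hF : UnrSeries.HasValueAt (spec e F) x v) : UnrSeries.HasValueAt₂ F x ((1 + x) ^ e - 1) v := by
  have hy := Summit.BirchSwinnertonDyer.Rank1Residual.X11b.norm_one_add_pow_sub_one_lt hx e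
  obtain ⟨Q, hQ⟩ := Ideal.mem_span_singleton'.mp (sub_toOuter_spec_mem_span e F)
  obtain ⟨w, hw⟩ := exists_hasValueAt₂ Q hx hy
  have hg := hasValueAt₂_lineGen_zero (p := p) e hx hy
  have hprod : UnrSeries.HasValueAt₂ (F - toOuter (spec e F)) x ((1 + x) ^ e - 1) 0 := by
    have := hasValueAt₂_mul hx hy hw hg
    rwa [mul_zero, hQ] at this
  have hout := (hasValueAt₂_toOuter_iff (spec e F) x ((1 + x) ^ e - 1) v).mpr hF
  have h := hasValueAt₂_add hprod hout
  rwa [sub_add_cancel, zero_add] at h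

/-- **The iff.** -/
theorem hasValueAt₂_line_iff_hasValueAt_spec (e : ℕ) (F : PowerSeries (UnrSeries p)) {x : ℂ_[p]} (hx : ‖x‖ < 1)
    (v : ℂ_[p]) : UnrSeries.HasValueAt₂ F x ((1 + x) ^ e - 1) v ↔ UnrSeries.HasValueAt (spec e F) x v :=
  ⟨hasValueAt_spec_of_hasValueAt₂ e hx, hasValueAt₂_of_hasValueAt_spec e hx⟩

/-- In the `…ThinCombDefs` coordinates: the generator `T₂ − ((1+T₁)^e − 1)` IS `C X − u_e`. -/
theorem lineGen_eq (e : ℕ) :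
    T₂ (unrIntegers p) - ((1 + T₁ (unrIntegers p)) ^ e - 1) = PowerSeries.C PowerSeries.X - uOuter e := rfl

end Summit.BirchSwinnertonDyer.BirchSwinnertonDyer.Theorems.UniversalToricDescentThinComb.LineValue

/-! ## §D  Line geometry of a v2 frame (utd-idea g46, evidence #45) -/

section LineGeometry

open Field
open Literature.NumberTheory.GaloisRepresentations

namespace Summit.BirchSwinnertonDyer.BirchSwinnertonDyer.Theorems.UniversalToricDescentThinComb.LineGeometry

variable {K : Type} [Field K] {p : ℕ} [Fact p.Prime]

/-- An avatar trivial at `σ` has value `1` there. -/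
theorem avatarValueAt_eq_one_of_apply_eq_one (r : FramedGaloisRep K (PadicAlgCl p) 1)
    {σ : absoluteGaloisGroup K} (h : r σ = 1) : avatarValueAt r σ = 1 := by
  simp [avatarValueAt, h]

/-- If `r` factors through `κ` and `γ' ≡ δ (mod ker κ)` then `φ̂(γ') = φ̂(δ)`. -/
theorem avatarValueAt_eq_of_mul_inv_mem_kerSubgroup {κ : ZpExtension K p}
    {r : FramedGaloisRep K (PadicAlgCl p) 1} (hr : FactorsThroughZp κ r) {γ' δ : absoluteGaloisGroup K}
    (h : γ' * δ⁻¹ ∈ κ.kerSubgroup) : avatarValueAt r γ' = avatarValueAt r δ := by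
  have h1 : avatarValueAt r (γ' * δ⁻¹) = 1 :=
    avatarValueAt_eq_one_of_apply_eq_one r (hr _ (ZpExtension.mem_kerSubgroup.mp h))
  have : avatarValueAt r γ' = avatarValueAt r (γ' * δ⁻¹ * δ) := by rw [inv_mul_cancel_right]
  rw [this, avatarValueAt_mul, h1, one_mul]

/-- First coordinate: `φ̂(γ₁) = φ̂(γ)` in a frame with `γ₁ * γ⁻¹ ∈ ker κ`. -/
theorem avatarValueAt_frame_fst {κ : ZpExtension K p} {r : FramedGaloisRep K (PadicAlgCl p) 1}
    (hr : FactorsThroughZp κ r) {γ₁ γ : absoluteGaloisGroup K} (h₁ : γ₁ * γ⁻¹ ∈ κ.kerSubgroup) :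
    avatarValueAt r γ₁ = avatarValueAt r γ :=
  avatarValueAt_eq_of_mul_inv_mem_kerSubgroup hr h₁

/-- Second coordinate: `φ̂(γ₂) = φ̂(γ)^{p^k}` in a frame with `γ₂ * (γ^{p^k})⁻¹ ∈ ker κ`. -/
theorem avatarValueAt_frame_snd {κ : ZpExtension K p} {r : FramedGaloisRep K (PadicAlgCl p) 1}
    (hr : FactorsThroughZp κ r) {γ₂ γ : absoluteGaloisGroup K} {k : ℕ}
    (h₂ : γ₂ * (γ ^ (p ^ k))⁻¹ ∈ κ.kerSubgroup) :
    avatarValueAt r γ₂ = avatarValueAt r γ ^ (p ^ k) := by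
  rw [avatarValueAt_eq_of_mul_inv_mem_kerSubgroup hr h₂,
    Summit.BirchSwinnertonDyer.BirchSwinnertonDyer.Theorems.RamifiedSevenEllipticUnits.LemmaXi.avatarValueAt_pow]

/-- **The interpolation point lies on the line `T₂ = (1 + T₁)^{p^k} − 1`.** -/
theorem interpolationPoint_mem_line {κ : ZpExtension K p} {r : FramedGaloisRep K (PadicAlgCl p) 1}
    (hr : FactorsThroughZp κ r) {γ₁ γ₂ γ : absoluteGaloisGroup K} {k : ℕ}
    (h₁ : γ₁ * γ⁻¹ ∈ κ.kerSubgroup) (h₂ : γ₂ * (γ ^ (p ^ k))⁻¹ ∈ κ.kerSubgroup) :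
    avatarValueAt r γ₂ - 1 = (1 + (avatarValueAt r γ₁ - 1)) ^ (p ^ k) - 1 := by
  rw [avatarValueAt_frame_snd hr h₂, avatarValueAt_frame_fst hr h₁, add_sub_cancel]

end Summit.BirchSwinnertonDyer.BirchSwinnertonDyer.Theorems.UniversalToricDescentThinComb.LineGeometry

end LineGeometry

end
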